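import Literature.AnabelianGeometry.EtaleTheta.Discharge.Sec5ConstantsDictionaryWitnessFacts
import Literature.AnabelianGeometry.EtaleTheta.Discharge.Sec5OfConstantsDictionary
import Literature.AnabelianGeometry.EtaleTheta.Discharge.Sec5InvariantUnitsOfBiratAction
import Literature.AnabelianGeometry.EtaleTheta.FrobenioidMonoThetaKummerExtension

/-!
# [EtTh] §5 ↔ §3 at the `CnstToy` datum: Lemma 5.8's `(K^×)^{1/N}/μ_N(B_N) ⥲ K^×`, its arithmetic step, and F-1306
# (`CyclotomicCharacterCompatX`) HOLD over every theta setting's own §2 model (Lemma 5.8 p. 331 / PDF p. 105)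

Mochizuki, *The étale theta function and its Frobenioid-theoretic manifestations*, Publ. RIMS **45** (2009)
[cite: MochizukiEtTh2009, Lem 5.8 p.331 (PDF p.105)].  abc-iut cell, layer L2, seat abc-iut-L2-t11 (gen 6); row «F-1306 +
Lemma 5.8's `(K^×)^{1/N}/μ_N(B_N) ⥲ K^×` AT THE `CnstToy` DATUM» (the successor item named by gen 5).  PROOF-ONLY sequel
(0 definitions, 0 new `Prop` facts, nothing landed is edited) of this seat's `ConstantsDictionaryWitness.lean` (p450110: the terms
`CnstToy.datum`, `CnstToy.act`, `CnstToy.muEquiv`, `CnstToy.reading`) and `Discharge/Sec5ConstantsDictionaryWitnessFacts.lean`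
(p454025: `constantsDictionary_datum`, `identifiesPiY_datum`), composed with the ONE-binder knit `Discharge/Sec5OfConstantsDictionary.lean`
(p439828), abc-iut-w4-d095's `kxRootNModCyclotome_of` (`FrobenioidMonoThetaKummerExtension.lean`) and abc-iut-f-115 / abc-iut-w4-d095's
`invariantUnitsEqConstants_of_conjFixed` / `constantsActByCyclotome_of_conjFixed` (`Discharge/Sec5InvariantUnitsOfBiratAction.lean`),
all consumed BY NAME.

Recall the datum (gen 5): for a theta setting `D` (base field `K ⊆ ℚ̄_p`), an étale theta datum `E`, a choice `X̲̲` (`Cu`), a level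
`N`, a cyclotome identification `μ` and the §1/§2 hypotheses `hC`, `hS`, the §5 datum `datum Cu μ hC hS = ThetaFrobenioid.ofThetaEnvData …`
over abc-iut-L2-t8's model `T := Cu.thetaEnvData μ hC hS` of Def. 2.13 ITSELF (`ι := refl`), with `Aut_C(B_N) := μ_N(J_N) ⋊ Γ`
(`J_N = K_N(a^{1/N})_{a ∈ K_N} ⊆ ℚ̄_p`, `Γ` = image of `G_K → Aut(J_N/ℚ_p)`), `O^×(B_N) = μ_N(J_N)`, `O^×(B_N^birat) := J_N^×`,
`ρ := Γ-restriction ∘ (Π^tp_X̲̲ ↠ G_K)`, `s^⊓-gp_N := inr`, constants `K^× ↪ J_N^×`, "the natural action" `act` through `Γ`.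

RESULTS (all at `datum Cu μ hC hS`, for EVERY `(D, E, Cu, N, μ, hC, hS)`).
* `torsion_mem_range_unitsToBirat_datum` — an `N`-torsion birational unit `f ∈ J_N^×` is (the image of) a unit: `f ∈ μ_N(J_N) = O^×(B_N)`;
* **`kxRootNModCyclotome_datum`** — abc-iut-L2-t4's `KxRootNModCyclotome`, BOTH clauses of Lemma 5.8's "we have a natural outer action
  of `(O_K^×)^{1/N}/μ_N(B_N) (⥲ O_K^×)` on `E_N`; this outer action extends to an outer action of `(K^×)^{1/N}/μ_N(B_N) (⥲ K^×)`": the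
  `N`-th power map `(K^×)^{1/N} → K^×` is ONTO (`ConstantsDictionary.hsurj` BY NAME: `ℚ̄_p` is algebraically closed and `x^N ∈ K ⇒ x ∈ J_N`)
  with kernel `μ_N(B_N)` (`kxRootNModCyclotome_of`);
* `sgpCapSection_datum` — `(s^⊓-gp_N(g))^bs = g` (`π ∘ inr = id`);
* `hgc_datum`, `invariantUnitsEqConstants_datum` — "`(O^×(B_N))^{Π^tp_Y} = O_K^×`" (abc-iut-w4-d095's L58-A3 `InvariantUnitsEqConstants`;
  GAP G-L2t4-4 `hgc`): a unit fixed by `s^⊓-gp_N(Im Π^tp_Y̲)` is a constant — Galois descent `ℚ̄_p^{G_K} = K` through the ONE binder;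
* **`constantsActByCyclotome_datum`** — abc-iut-L2-t4's named ARITHMETIC STEP of Lemma 5.8 (`ConstantsActByCyclotome`, the `Facts` field:
  "this last set [the units on which `Π^tp_Y` acts via multiplication by an element of `μ_N(B_N)`] is easily seen to coincide with
  `(O_K^×)^{1/N}`") HOLDS at the datum;
* `kxOuterActionExtends_datum` — abc-iut-w4-d095's L58-B1 "extends to an outer action of `(K^×)^{1/N}/μ_N(B_N)` on `E_N`";
* `hgeom_datum` — GAP G-L2t11-1: an element of `Π^tp_Y̲` over `1 ∈ G_K` fixes the `N`-th roots of constants;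
* **`cyclotomicCharacterCompatX_datum`** — FACT row **F-1306** `CyclotomicCharacterCompatX` (and abc-iut-L2-t4's `Π^tp_Y̲`-form
  `CyclotomicCharacterCompat`) at the datum against `T` with `ι := refl`, `m := muEquiv`: "`Π^tp_Y` [i.e., `G_K`, via the natural surjection
  `Π^tp_Y ↠ G_K`] acts [on `μ_N(B_N)`] via" the cyclotomic character — conjugation by `s^⊓-gp_N(ρ g)` on `μ_N(B_N) = μ_N(J_N)` IS the Galois
  action of `aug(g) ∈ G_K` (`ul_conj`), which on `μ_N(ℚ̄_p)` is `χ(aug g)` (abc-iut-L2-t8's `thetaEnvData_chi_dictionary`) — obtained through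
  the ONE-binder knit `ConstantsDictionary.cyclotomicCharacterCompatX`, not by direct `ℚ̄_p`-arithmetic; unfolded form `muEquiv_conj_sgpCap_rho`;
* `exists_cyclotomicCharacterCompatX_modelχ` — census form, binder-free AT THE RECORD MODEL `modelχ p` (abc-iut-L2-d1's `doubleUnderlineχSec`,
  abc-iut-L2-t8's `modelχ_sec2Hyps` / `modelχ_nonempty_cyclotomeMod` BY NAME).
So at ONE `ofThetaEnvData`-shaped §5 datum over the setting's OWN §2 model the junction binders {`hD` (`ConstantsDictionary`), `hY`, `hYdd`,
`hK` (`KxRootNModCyclotome`), `hsurj`, `hgc`, `hgeom`, F-1306, `ConstantsActByCyclotome`, `SgpCapSection`} hold SIMULTANEOUSLY.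
HONEST LABEL: a model-instance / consistency witness (FACT row F-1306 is «instance forms model-witnessed»); the datum is a toy — NOT the
tempered Frobenioid of a curve (trivial divisor monoids, `A_⊚ = A_N = B_N`, `s^⊔-gp_N := 1`, so e.g. `SgpCupSection` and the full bundle
`Facts` are NOT claimed here); nothing of [EtTh] is asserted; typed ≠ proved; no side is taken on anything downstream ([IUTchIII] Cor. 3.12).
-/

noncomputable section

namespace Literature.AnabelianGeometry.EtaleTheta

open CategoryTheory Literature.AnabelianGeometry.SemiGraphs IntermediateField

namespace ThetaFrobenioid

namespace CnstToy

variable {p : ℕ} [Fact p.Prime] {D : ThetaSetting p} {N : ℕ+} {E : D.EtaleThetaData} {l : ℕ}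
  (Cu : E.DoubleUnderline l) (μ : D.CyclotomeMod l N) (hC : D.Compat) (hS : D.Sec2Hyps)

/-! ### Lemma 5.8: `(K^×)^{1/N}/μ_N(B_N) ⥲ K^×` at the datum -/

/-- **An `N`-torsion birational unit of the datum is a unit**: `f ∈ J_N^×` with `f^N = 1` lies in `μ_N(J_N) = O^×(B_N)`, i.e. is
`unitsToBirat` of the unit `inl f ∈ μ_N(J_N) ⋊ Γ = Aut_C(B_N)` (the input (h5) "the `N`-torsion of `O^×(B_N^birat)` consists of units"
of abc-iut-w4-d095's `kxRootNModCyclotome_of`).  [cite: MochizukiEtTh2009, Lem 5.8 p.331 (PDF p.105)] -/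
theorem torsion_mem_range_unitsToBirat_datum (f : (datum Cu μ hC hS).biratUnits (datum Cu μ hC hS).BN)
    (hf : f ^ ((datum Cu μ hC hS).N : ℕ) = 1) :
    f ∈ ((datum Cu μ hC hS).unitsToBirat (datum Cu μ hC hS).BN).range := by
  have hζ : @Membership.mem ((J D N)ˣ) (Subgroup (J D N)ˣ) SetLike.instMembership (rootsOfUnity N (J D N)) f :=
    (mem_rootsOfUnity _ _).mpr hf
  exact ⟨⟨Toy.autEquiv (G D N) (SemidirectProduct.inl ⟨f, hζ⟩),
    (datum Cu μ hC hS).muTorsion_le_units _ _ (autEquiv_inl_mem_muTorsion Cu μ hC hS ⟨f, hζ⟩)⟩, rfl⟩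

/-- **[EtTh] Lemma 5.8, "`(O_K^×)^{1/N}/μ_N(B_N) (⥲ O_K^×)` … extends to … `(K^×)^{1/N}/μ_N(B_N) (⥲ K^×)`" AT THE DATUM** (abc-iut-L2-t4's
`KxRootNModCyclotome`, both clauses): the `N`-th power map `(K^×)^{1/N} → K^×` is onto — `ℚ̄_p` is algebraically closed and an `N`-th root
`x` of `k ∈ K` has `x^N ∈ K ⊆ K_N`, so `x ∈ J_N` (`ConstantsDictionary.hsurj` of the ONE binder, gen 4/5) — and its kernel is `μ_N(B_N)`
(`kxRootNModCyclotome_of`, abc-iut-w4-d095, from `torsion_mem_range_unitsToBirat_datum`).  [cite: MochizukiEtTh2009, Lem 5.8 p.331 (PDF p.105)] -/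
theorem kxRootNModCyclotome_datum : (datum Cu μ hC hS).KxRootNModCyclotome :=
  (datum Cu μ hC hS).kxRootNModCyclotome_of (constantsDictionary_datum Cu μ hC hS).hsurj
    fun f _ hf => torsion_mem_range_unitsToBirat_datum Cu μ hC hS f hf

/-- Lemma 5.8 "`(K^×)^{1/N} → K^×` onto" (abc-iut-L2-t4's `hsurj`) at the datum, from the ONE binder.
[cite: MochizukiEtTh2009, Lem 5.8 p.331 (PDF p.105)] -/
theorem hsurj_datum : ∀ k : (datum Cu μ hC hS).Kˣ, ∃ f ∈ (datum Cu μ hC hS).KxRootN,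
    f ^ ((datum Cu μ hC hS).N : ℕ) = (datum Cu μ hC hS).constEmb k :=
  (constantsDictionary_datum Cu μ hC hS).hsurj

/-! ### `(s^⊓-gp_N(g))^bs = g` and the geometric-connectedness step "`(O^×(B_N))^{Π^tp_Y} = O_K^×`" -/

/-- `(β)^bs` of an automorphism `β` of `B_N` of the datum is `π(β) ∈ Γ` (the base functor is `Bπ`).
[cite: MochizukiEtTh2009, §5 p.331 (PDF p.105)] -/
theorem autBase_hom_datum (a : Aut (datum Cu μ hC hS).BN) :
    ((datum Cu μ hC hS).autBase (datum Cu μ hC hS).BN a).hom = π D N (Toy.homOf (G D N) _ a) := rfl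

/-- **`SgpCapSection` at the datum**: `(s^⊓-gp_N(g))^bs = g`, since `s^⊓-gp_N = inr` and `π ∘ inr = id` (the section property that
abc-iut-L2-t4 derives from `SgpCapSpec` + `StrvSection` for the genuine data).  [cite: MochizukiEtTh2009, §5 p.331 (PDF p.105)] -/
theorem sgpCapSection_datum : (datum Cu μ hC hS).SgpCapSection := by
  intro b
  apply Aut.ext
  rw [autBase_hom_datum]
  change π D N (Toy.homOf (G D N) _ (Toy.autEquiv (G D N) (SemidirectProduct.inr ((Toy.autEquiv (Gam D N)).symm b)))) =
    b.hom
  rw [Toy.homOf_autEquiv, SemidirectProduct.rightHom_inr]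
  have hb : (Toy.autEquiv (Gam D N)).symm b = Toy.homOf (Gam D N) (SingleObj.star (Gam D N)) b :=
    (MulEquiv.symm_apply_eq _).mpr (Aut.ext rfl)
  rw [hb]
  rfl

/-- **GAP G-L2t4-4 `hgc` at the datum** ("since `Y` is geometrically connected over `K`", Lemma 5.8 proof): a unit of `B_N` commuting with
`s^⊓-gp_N(Im Π^tp_Y̲)` is a constant of `K` — from the ONE binder (`ConstantsDictionary.hgc`: Galois descent `ℚ̄_p^{G_K} = K`) and
`IdentifiesPiY` (rfl at `ι := refl`, `identifiesPiY_datum`).  [cite: MochizukiEtTh2009, Lem 5.8 proof p.331 (PDF p.105)] -/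
theorem hgc_datum : ∀ u : (datum Cu μ hC hS).units (datum Cu μ hC hS).BN,
    (∀ y ∈ (datum Cu μ hC hS).imPiY,
      (datum Cu μ hC hS).sgpCap y * (u : Aut (datum Cu μ hC hS).BN) * ((datum Cu μ hC hS).sgpCap y)⁻¹ = u) →
      (datum Cu μ hC hS).unitsToBirat (datum Cu μ hC hS).BN u ∈ (datum Cu μ hC hS).constEmb.range :=
  (constantsDictionary_datum Cu μ hC hS).hgc (identifiesPiY_datum Cu μ hC hS)

/-- **abc-iut-w4-d095's L58-A3 "`(O^×(B_N))^{Π^tp_Y} = O_K^×`" (`InvariantUnitsEqConstants`) HOLDS at the datum**: a unit is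
`s^⊓-gp_N(Im Π^tp_Y̲)`-fixed iff its birational image is a constant (`invariantUnitsEqConstants_of_conjFixed` of the natural action `act`
and `hgc_datum`).  [cite: MochizukiEtTh2009, Lem 5.8 proof p.331 (PDF p.105)] -/
theorem invariantUnitsEqConstants_datum : (datum Cu μ hC hS).InvariantUnitsEqConstants :=
  (datum Cu μ hC hS).invariantUnitsEqConstants_of_conjFixed (act Cu μ hC hS) (hgc_datum Cu μ hC hS)

/-- **[EtTh] Lemma 5.8, ARITHMETIC STEP (abc-iut-L2-t4's named fact `ConstantsActByCyclotome`, a field of the bundle `Facts`) HOLDS at the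
datum**: "`(O_K^×)^{1/N}` … this last set [the elements of `O^×(B_N)` on which `Π^tp_Y` [i.e., `G_K`, via the natural surjection `Π^tp_Y ↠ G_K`]
acts via multiplication by an element of `μ_N(B_N)`] is easily seen to coincide with `(O_K^×)^{1/N}`" — by abc-iut-w4-d095's Kummer criterion
(`constantsActByCyclotome_of_conjFixed`) from the natural action and `hgc_datum`.  [cite: MochizukiEtTh2009, Lem 5.8 proof p.331 (PDF p.105)] -/
theorem constantsActByCyclotome_datum : (datum Cu μ hC hS).ConstantsActByCyclotome :=
  (datum Cu μ hC hS).constantsActByCyclotome_of_conjFixed (act Cu μ hC hS) (hgc_datum Cu μ hC hS)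

/-- **[EtTh] Lemma 5.8 "this outer action extends to an outer action of `(K^×)^{1/N}/μ_N(B_N) (⥲ K^×)` on `E_N`" at the datum**
(abc-iut-w4-d095's `KxOuterActionExtends`, via `kxOuterActionExtends_of_biratAutAction` from `act`, `SgpCapSection` and `KxRootNModCyclotome`).
[cite: MochizukiEtTh2009, Lem 5.8 p.331 (PDF p.105)] -/
theorem kxOuterActionExtends_datum : (datum Cu μ hC hS).KxOuterActionExtends :=
  (datum Cu μ hC hS).kxOuterActionExtends_of_biratAutAction (sgpCapSection_datum Cu μ hC hS) (act Cu μ hC hS)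
    (kxRootNModCyclotome_datum Cu μ hC hS)

/-- **GAP G-L2t11-1 `hgeom` at the datum**: an element `y ∈ Π^tp_Y̲` over `1 ∈ G_K` acts trivially on the `N`-th roots of constants
(from the ONE binder, `ConstantsDictionary.hgeom`, with `hK := kxRootNModCyclotome_datum`).  [cite: MochizukiEtTh2009, Lem 5.8 proof p.331 (PDF p.105)] -/
theorem hgeom_datum (f : (datum Cu μ hC hS).KxRootN) (y : (datum Cu μ hC hS).PiX) (hy : y ∈ (datum Cu μ hC hS).PiY)
    (haug : (Cu.thetaEnvData μ hC hS).aug y = 1) :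
    (act Cu μ hC hS).act ((datum Cu μ hC hS).sgpCap ((datum Cu μ hC hS).ρ y))
      (f : (datum Cu μ hC hS).biratUnits (datum Cu μ hC hS).BN) = f :=
  (constantsDictionary_datum Cu μ hC hS).hgeom (kxRootNModCyclotome_datum Cu μ hC hS) f y hy haug

/-! ### F-1306 `CyclotomicCharacterCompatX` at the datum -/

/-- **FACT row F-1306 (`CyclotomicCharacterCompatX`, [EtTh] Lemma 5.8 proof) HOLDS at the datum** against the setting's own §2 model
`T := Cu.thetaEnvData μ hC hS` with `ι := refl`, `m := muEquiv`: for every `g ∈ Π^tp_X̲̲` and units `u, u' ∈ μ_N(B_N)` with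
`u' = s^⊓-gp_N(ρ g) · u · s^⊓-gp_N(ρ g)⁻¹`, `m(u') = χ(aug g) · m(u)` — "`Π^tp_Y` [i.e., `G_K`, via the natural surjection `Π^tp_Y ↠ G_K`]
acts … via multiplication by an element of `μ_N(B_N)`": conjugation in `μ_N(J_N) ⋊ Γ` IS the Galois action of `aug(g)` on `μ_N(J_N) ⊆ μ_N(ℚ̄_p)`,
which is the mod-`N` cyclotomic character (abc-iut-L2-t8's `thetaEnvData_chi_dictionary`).  Obtained through the ONE-binder knit
`ConstantsDictionary.cyclotomicCharacterCompatX` (gen 4, p439828) from `constantsDictionary_datum` (gen 5) and `kxRootNModCyclotome_datum`.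
[cite: MochizukiEtTh2009, Lem 5.8 proof p.331 (PDF p.105)] -/
theorem cyclotomicCharacterCompatX_datum :
    (datum Cu μ hC hS).CyclotomicCharacterCompatX (Cu.thetaEnvData μ hC hS)
      (ContinuousMulEquiv.refl (datum Cu μ hC hS).PiX).toMulEquiv (muEquiv Cu μ hC hS) :=
  (constantsDictionary_datum Cu μ hC hS).cyclotomicCharacterCompatX (kxRootNModCyclotome_datum Cu μ hC hS)

/-- F-1306 at the datum, UNFOLDED: `m(s^⊓-gp_N(ρ g) · u · s^⊓-gp_N(ρ g)⁻¹) = χ(aug g) · m(u)` for `g ∈ Π^tp_X̲̲`, `u ∈ μ_N(B_N)`.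
[cite: MochizukiEtTh2009, Lem 5.8 proof p.331 (PDF p.105)] -/
theorem muEquiv_conj_sgpCap_rho (g : (datum Cu μ hC hS).PiX)
    (u u' : (datum Cu μ hC hS).muTorsion (datum Cu μ hC hS).BN (datum Cu μ hC hS).N)
    (hu : (u' : Aut (datum Cu μ hC hS).BN) =
      (datum Cu μ hC hS).sgpCap ((datum Cu μ hC hS).ρ g) * u * ((datum Cu μ hC hS).sgpCap ((datum Cu μ hC hS).ρ g))⁻¹) :
    muEquiv Cu μ hC hS u' = (Cu.thetaEnvData μ hC hS).chi ((Cu.thetaEnvData μ hC hS).aug g) (muEquiv Cu μ hC hS u) :=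
  cyclotomicCharacterCompatX_datum Cu μ hC hS g u u' hu

/-- F-1306 in abc-iut-L2-t4's `Π^tp_Y̲`-form (`CyclotomicCharacterCompat`) at the datum.  [cite: MochizukiEtTh2009, Lem 5.8 proof p.331 (PDF p.105)] -/
theorem cyclotomicCharacterCompat_datum :
    (datum Cu μ hC hS).CyclotomicCharacterCompat (Cu.thetaEnvData μ hC hS)
      (ContinuousMulEquiv.refl (datum Cu μ hC hS).PiX).toMulEquiv (muEquiv Cu μ hC hS) :=
  (cyclotomicCharacterCompatX_datum Cu μ hC hS).toY

/-- **Census form (binders = the construction data only)**: for every theta setting and every `(E, X̲̲, N, μ, hC, hS)` there EXIST a §5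
datum over the setting's §2 model `Cu.thetaEnvData μ hC hS`, an identification of `Π`'s and a cyclotome identification satisfying F-1306
`CyclotomicCharacterCompatX` TOGETHER WITH `KxRootNModCyclotome` and Lemma 5.8's arithmetic step `ConstantsActByCyclotome`.
[cite: MochizukiEtTh2009, Lem 5.8 proof p.331 (PDF p.105)] -/
theorem exists_cyclotomicCharacterCompatX :
    ∃ (ι : (datum Cu μ hC hS).PiX ≃ₜ* (Cu.thetaEnvData μ hC hS).PiX)
      (m : (datum Cu μ hC hS).muTorsion (datum Cu μ hC hS).BN (datum Cu μ hC hS).N ≃* (Cu.thetaEnvData μ hC hS).mu),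
      (datum Cu μ hC hS).CyclotomicCharacterCompatX (Cu.thetaEnvData μ hC hS) ι.toMulEquiv m ∧
        (datum Cu μ hC hS).KxRootNModCyclotome ∧ (datum Cu μ hC hS).ConstantsActByCyclotome :=
  ⟨_, _, cyclotomicCharacterCompatX_datum Cu μ hC hS, kxRootNModCyclotome_datum Cu μ hC hS,
    constantsActByCyclotome_datum Cu μ hC hS⟩

/-- **Census form AT THE χ-TWISTED RECORD MODEL `modelχ p`, binder-free**: for every prime `p`, odd `l` and level `N`, with abc-iut-L2-d1's
choice `X̲̲ := doubleUnderlineχSec p l hl`, abc-iut-L2-t8's cyclotome identification and §1/§2 hypotheses, the §5 datum over the record model's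
mono-theta environment satisfies F-1306 `CyclotomicCharacterCompatX` (with `ι := refl`, `m := muEquiv`), `KxRootNModCyclotome` and
`ConstantsActByCyclotome` (HONEST LABEL: `modelχ` is a semi-synthetic model of the typed §1 interface and the §5 datum is a toy;
consistency evidence only).  [cite: MochizukiEtTh2009, Lem 5.8 proof p.331 (PDF p.105)] -/
theorem exists_cyclotomicCharacterCompatX_modelχ (p : ℕ) [Fact p.Prime] (l : ℕ+) (hl : Odd (l : ℕ)) (N : ℕ+) :
    ∃ (μ : (ThetaSetting.modelχ p).CyclotomeMod l N)
      (ι : (datum (SettingModel.doubleUnderlineχSec p l hl) μ (ThetaSetting.modelχ_sec2Hyps p).compat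
        (ThetaSetting.modelχ_sec2Hyps p)).PiX ≃ₜ*
          ((SettingModel.doubleUnderlineχSec p l hl).thetaEnvData μ (ThetaSetting.modelχ_sec2Hyps p).compat
            (ThetaSetting.modelχ_sec2Hyps p)).PiX)
      (m : (datum (SettingModel.doubleUnderlineχSec p l hl) μ (ThetaSetting.modelχ_sec2Hyps p).compat
          (ThetaSetting.modelχ_sec2Hyps p)).muTorsion
            (datum (SettingModel.doubleUnderlineχSec p l hl) μ (ThetaSetting.modelχ_sec2Hyps p).compat
              (ThetaSetting.modelχ_sec2Hyps p)).BN N ≃*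
          ((SettingModel.doubleUnderlineχSec p l hl).thetaEnvData μ (ThetaSetting.modelχ_sec2Hyps p).compat
            (ThetaSetting.modelχ_sec2Hyps p)).mu),
      (datum (SettingModel.doubleUnderlineχSec p l hl) μ (ThetaSetting.modelχ_sec2Hyps p).compat
          (ThetaSetting.modelχ_sec2Hyps p)).CyclotomicCharacterCompatX
        ((SettingModel.doubleUnderlineχSec p l hl).thetaEnvData μ (ThetaSetting.modelχ_sec2Hyps p).compat
          (ThetaSetting.modelχ_sec2Hyps p)) ι.toMulEquiv m ∧
      (datum (SettingModel.doubleUnderlineχSec p l hl) μ (ThetaSetting.modelχ_sec2Hyps p).compat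
          (ThetaSetting.modelχ_sec2Hyps p)).KxRootNModCyclotome ∧
      (datum (SettingModel.doubleUnderlineχSec p l hl) μ (ThetaSetting.modelχ_sec2Hyps p).compat
          (ThetaSetting.modelχ_sec2Hyps p)).ConstantsActByCyclotome := by
  obtain ⟨μ⟩ := SettingModel.modelχ_nonempty_cyclotomeMod p l.pos N
  exact ⟨μ, _, _, cyclotomicCharacterCompatX_datum (SettingModel.doubleUnderlineχSec p l hl) μ
    (ThetaSetting.modelχ_sec2Hyps p).compat (ThetaSetting.modelχ_sec2Hyps p),
    kxRootNModCyclotome_datum _ μ _ _, constantsActByCyclotome_datum _ μ _ _⟩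

end CnstToy

end ThetaFrobenioid

end Literature.AnabelianGeometry.EtaleTheta

end
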